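import Literature.Computability.Complexity.BranchingProgramEntropy
import Literature.Algebra.EuclideanLattices.GapCVPInstanceCodeFP
import Summits.PneNP.PneNP.Theorems.SzkEntropyPeaThreeNotInPSocketAffineBit
import HarnessLib

/-!
# Route SzkEntropy, crux `PeaThreeNotInP` (stmt-PneNP-10776), line `SketchIdeator3`, socket client
# `lattice-cube-smoothing`: DEFINITIONS of the Karp reduction `GapCVP_n → PEDBPGap 1 10`

The objects of the lattice client of the entropy-difference socket (crux idea card
`Cruxes/PeaThreeNotInP/Ideas/lattice-cube-smoothing.md`): from a `GapCVP` instance `((B, t), d)`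
(integer basis ROWS `b₁ … bₙ`, integer target `t`, rational `d = a / den`) two branching-program
samplers on the SAME input bits `u = (b, z, e)` — one bit `b`, `n` coefficients `z_{i'} < 2^ℓ`,
`n` noise coordinates `e_i < M = 2^m`, all read in binary off the input bits —

* `p(b, z, e) = K · (∑_{i'} z_{i'} b_{i'}) + e + b · K t ∈ ℤⁿ`   (programs `progsP`),
* `q(b, z, e) = (K · (∑_{i'} z_{i'} b_{i'}) + e, b)`              (programs `progsQ`),

each output coordinate written with `W` bits, each bit the CARRY AUTOMATON `affineBitRaw` of the
signed affine form of the input bits (landed: `SocketBP.stub_affineBitRaw_fn`).  FAR instances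
(`dist(t, L(B)) > n d`) give disjoint translates, `H(p) = H(q)`; CLOSE instances (`dist ≤ d`) give
overlapping translates, `H(p) + 1/10 ≤ H(q)`: the reduction lands in `(PEDBPGap 1 10).swap`.

Parameters (all functions of the raw instance data `CVPTup`, the `GapCodes.cvpTup` format
`((n, (row-major B, target list)), (num d, den d))`): `a = num⁺`, `S₀ = Σ|B| + Σ|t| + a + 1`,
`M = 2^m`, `m = size (64 n a)` (so `64 n a < M`), `K = ⌈(M − 1) den / (a √n)⌉` computed as
`Nat.sqrt (c − 1) + 1` with `c = ⌈(M−1)² den² / (n a²)⌉` (so `(M−1) den ≤ √n K a ≤ (M−1) den + 2 √n a`),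
`ℓ = 5 + (n+1) size (n S₀ + 1)` (so `32 n · n! · S₀ⁿ ≤ 2^ℓ`, killing the box boundary of `z`),
`W = ℓ + m + size (K S₀) + 1` (so every output coordinate is `< 2^W`), `N = n ℓ + n m + 1` input bits.
Dimension `n = 0` is sent to a fixed NO-instance, `n = 1` is decided exactly (`oneDimFar`:
`dist(t, g ℤ) = min (t mod |g|, |g| − t mod |g|)`) and sent to fixed instances `yesI` / `noI`.

Also here (typed side of the analysis): the box `Box n ℓ m`, the typed samplers `sampG` / `sampF`,
and the decoders `ext` / `bitsVal` / `yQ` / `yP` reading `z`, `e`, `b` off an input `u : Fin N → F₂`.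

This file is definitions only (reviewed); the stubs of the line (`stub_bpSemantics`, `stub_reindex`,
`stub_geometry`, `stub_overlap`, `stub_params`, `stub_affineFP`, `stub_instanceFP`, `stub_gap`) and
the assembly `gapCVPPromise (fun n => n) ≤ₚ (PEDBPGap 1 10).swap`, hence
`LatticeGapsvpNNotP → PeaThreeNotInP`, live in sibling files.

References: O. Goldreich, S. Goldwasser, J. Comput. Syst. Sci. 60 (2000) §3 (the ball-overlap
protocol for `GapCVP`); D. Micciancio, S. Vadhan, CRYPTO 2003 §3; Z. Dvir, D. Gutfreund,
G. N. Rothblum, S. Vadhan, ECCC TR10-160 (2010) §4.2–4.4 (branching-program samplers, lattice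
problems in `SZKP_L`); I. Wegener, *Branching programs and binary decision diagrams* (2000) §1.1;
D. Micciancio, S. Goldwasser, *Complexity of Lattice Problems* (2002) Ch. 1 §1.2 (instance format).
-/

namespace Summit.PneNP.PneNP.Cruxes.PeaThreeNotInP.LatticeLine

set_option linter.dupNamespace false -- `Summit.PneNP.PneNP.…`: summit = sub-problem name (D-0017)

open Finset
open Literature.Computability.Complexity Literature.Algebra.EuclideanLattices
open Summit.PneNP.PneNP.Cruxes.PeaThreeNotInP.SocketBP (affineBitRaw)

/-! ### Raw instance data and parameters -/

/-- The raw data of a `GapCVP` instance in the format of `GapCodes.cvpTup`: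
`((n, (row-major entries of B, entries of t)), (num d, den d))`. [cite: MicciancioGoldwasser2002, Ch. 1 §1.2] -/
abbrev CVPTup : Type := (ℕ × (List ℤ × List ℤ)) × (ℤ × ℕ)

namespace CVPTup

variable (c : CVPTup)

/-- The dimension `n`. [folklore] -/
def n : ℕ := c.1.1

/-- The row-major entry list of the basis (`n²` integers, rows = basis vectors). [folklore] -/
def flat : List ℤ := c.1.2.1

/-- The entry list of the target `t`. [folklore] -/
def tl : List ℤ := c.1.2.2

/-- The numerator of the threshold `d`. [folklore] -/
def num : ℤ := c.2.1

/-- The denominator of the threshold `d` (positive on codes of rationals). [folklore] -/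
def den : ℕ := c.2.2

/-- `a = num⁺`, the numerator as a natural number (`d > 0` on the promise). [folklore] -/
def a : ℕ := c.num.toNat

/-- The basis entry `B i' i` (row `i'`, column `i`), `0` out of range. [folklore] -/
def entry (i' i : ℕ) : ℤ := c.flat.getD (i' * c.n + i) 0

/-- The target entry `t i`, `0` out of range. [folklore] -/
def tgt (i : ℕ) : ℤ := c.tl.getD i 0

/-- The magnitude budget `S₀ = Σ |B| + Σ |t| + a + 1 ≥ 1`: at least every `|B i' i|`, every
`|t i| + d`, and `a`. [folklore] -/
def S₀ : ℕ := (c.flat.map Int.natAbs).sum + (c.tl.map Int.natAbs).sum + c.a + 1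

/-- The number `m = size (64 n a)` of bits of a noise coordinate (`64 n a < 2^m`). [folklore] -/
def m : ℕ := Nat.size (64 * c.n * c.a)

/-- The side `M = 2^m` of the noise cube `[0, M)ⁿ`. [folklore] -/
def M : ℕ := 2 ^ c.m

/-- `c = ⌈(M − 1)² den² / (n a²)⌉` (ceiling division; junk `0` when `n a² = 0`). [folklore] -/
def cK : ℕ := ((c.M - 1) ^ 2 * c.den ^ 2 + c.n * c.a ^ 2 - 1) / (c.n * c.a ^ 2)

/-- The scaling factor `K = ⌈√c⌉ = Nat.sqrt (c − 1) + 1 ≥ 1`, the least integer with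
`n K² a² ≥ (M − 1)² den²`, i.e. `√n · K · d ≥ M − 1` (the cube's `ℓ₂`-diameter `√n (M−1)` fits under
the far threshold `n · K d`), and `√n K a ≤ (M − 1) den + 2 √n a`. [folklore] -/
def K : ℕ := Nat.sqrt (c.cK - 1) + 1

/-- The number `ℓ = 5 + (n + 1) · size (n S₀ + 1)` of bits of a coefficient `z_{i'}`
(`32 · n · n! · S₀ⁿ ≤ 2^ℓ`: the coefficients of a closest vector are `≤ n! S₀ⁿ` by Cramer–Hadamard,
`natAbs_coeff_le`, so translating the `z`-box by them loses at most `1/32` of it). [folklore] -/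
def ℓ : ℕ := 5 + (c.n + 1) * Nat.size (c.n * c.S₀ + 1)

/-- The number `W = ℓ + m + size (K S₀) + 1` of output bits per coordinate (every translated output
coordinate is `< K S₀ 2^ℓ + 2^m < 2^W`). [folklore] -/
def W : ℕ := c.ℓ + c.m + Nat.size (c.K * c.S₀) + 1

/-- The number `n ℓ + n m` of input bits carrying `z` and `e`. [folklore] -/
def nzE : ℕ := c.n * c.ℓ + c.n * c.m

/-- The number `N = n ℓ + n m + 1` of input bits `u = (b, z, e)`: bit `0` is `b`, bit
`1 + i' ℓ + s` is bit `s` of `z_{i'}`, bit `1 + n ℓ + i m + s` is bit `s` of `e_i`. [folklore] -/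
def N : ℕ := c.nzE + 1

/-- The coefficient of input bit `1 + k` (`k < n ℓ + n m`) in output coordinate `i` of the lattice
part `K · (∑_{i'} z_{i'} b_{i'})_i + e_i`: `K · B i' i · 2^s` on bit `s` of `z_{i'}`, `2^s` on bit `s`
of `e_i`, `0` on the bits of the other noise coordinates. [folklore] -/
def coefZE (i k : ℕ) : ℤ :=
  if k < c.n * c.ℓ then (c.K : ℤ) * c.entry (k / c.ℓ) i * 2 ^ (k % c.ℓ)
  else if (k - c.n * c.ℓ) / c.m = i then 2 ^ ((k - c.n * c.ℓ) % c.m) else 0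

/-- The coefficient list (length `N`) of output coordinate `i` of the sampler `p`: `K t_i` on the
bit `b`, then `coefZE`. [folklore] -/
def csP (i : ℕ) : List ℤ := ((c.K : ℤ) * c.tgt i) :: (List.range c.nzE).map (c.coefZE i)

/-- The coefficient list (length `N`) of output coordinate `i` of the sampler `q`: `0` on the bit
`b`, then `coefZE`. [folklore] -/
def csQ (i : ℕ) : List ℤ := 0 :: (List.range c.nzE).map (c.coefZE i)

/-- The coefficient list (length `N`) of the last output of `q`, the bit `b` itself. [folklore] -/
def csB : List ℤ := 1 :: List.replicate c.nzE 0

/-- **The programs of the sampler `p`**: program `r = i W + j` (`i < n`, `j < W`) is the carry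
automaton of bit `j` of output coordinate `i`. [cite: DvirGutfreundRothblumVadhan2010, §4.2] -/
def progsP : List RawBP :=
  (List.range (c.n * c.W)).map fun r => affineBitRaw (c.csP (r / c.W)) (r % c.W)

/-- **The programs of the sampler `q`**: the `n W` bit programs of the lattice part, then the
program reading the bit `b`. [cite: DvirGutfreundRothblumVadhan2010, §4.2] -/
def progsQ : List RawBP :=
  ((List.range (c.n * c.W)).map fun r => affineBitRaw (c.csQ (r / c.W)) (r % c.W)) ++
    [affineBitRaw c.csB 0]

/-- The generic image (dimension `n ≥ 2`): the pair of samplers `(p, q)` on `N` input bits.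
[cite: DvirGutfreundRothblumVadhan2010, Thm 4.6] -/
def generic : PEDBPInst := ((c.N, c.progsP), (c.N, c.progsQ))

end CVPTup

/-! ### Fixed instances and the one-dimensional decision -/

/-- A fixed YES-instance of every `PEDBPGap num den`: two empty samplers (`H(p) = H(q) = 0`). [folklore] -/
def yesI : PEDBPInst := ((0, []), (0, []))

/-- The raw 3-node program reading the input bit `x₀` (nodes: `0`-sink, `1`-sink, root testing
`x₀`). [folklore] -/
def bitRaw : RawBP := [(0, 0, 0, 0), (1, 0, 0, 0), (2, 0, 0, 1)]

/-- A fixed NO-instance of every `PEDBPGap num den` with `num ≤ den`: `p` empty (`H = 0`) against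
the one-bit sampler `q(x₀) = x₀` (`H = 1`). [folklore] -/
def noI : PEDBPInst := ((0, []), (1, [bitRaw]))

/-- **The one-dimensional far test**: for the lattice `g ℤ` (`g ≠ 0`) and the target `t`,
`dist(t, g ℤ) = min (t mod |g|) (|g| − t mod |g|)`, so the instance is FAR (`d = num / den < dist`)
iff `num < den · min (t mod |g|) (|g| − t mod |g|)`. [folklore] -/
def oneDimFar (g t num : ℤ) (den : ℕ) : Bool :=
  decide (num < (den : ℤ) * min (t % |g|) (|g| - t % |g|))

/-- **The instance map on raw data**: dimension `0` ↦ the fixed NO-instance (such instances are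
YES-instances of `GapCVP` whenever they satisfy the promise), dimension `1` ↦ decided exactly,
dimension `≥ 2` ↦ the cube-smoothed coset samplers. [cite: DvirGutfreundRothblumVadhan2010, §4.4] -/
def latRedTup (c : CVPTup) : PEDBPInst :=
  if c.n = 0 then noI
  else if c.n = 1 then (if oneDimFar (c.entry 0 0) (c.tgt 0) c.num c.den then yesI else noI)
  else c.generic

/-- **The instance map `GapCVP → PEDBPGap`** on typed instances: the raw map on the `cvpTup` data.
[cite: DvirGutfreundRothblumVadhan2010, §4.4] -/
def latRed (p : GapCVPInstance) : PEDBPInst := latRedTup (GapCodes.cvpTup p)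

/-! ### Typed side: the box, the samplers, the decoders -/

/-- The sample space of `(z, e)`: `z ∈ [0, 2^ℓ)ⁿ`, `e ∈ [0, 2^m)ⁿ`. [folklore] -/
abbrev Box (n ℓ m : ℕ) : Type := (Fin n → Fin (2 ^ ℓ)) × (Fin n → Fin (2 ^ m))

/-- **The sampler `g(z, e) = K · (∑_{i'} z_{i'} b_{i'}) + e`** (coordinate `i`:
`∑_{i'} K · B i' i · z_{i'} + e_i`). [cite: GoldreichGoldwasser2000, §3] -/
def sampG (n : ℕ) (K : ℤ) (B : Matrix (Fin n) (Fin n) ℤ) {ℓ m : ℕ} (ze : Box n ℓ m) : Fin n → ℤ :=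
  fun i => (∑ i', K * B i' i * ((ze.1 i' : ℕ) : ℤ)) + ((ze.2 i : ℕ) : ℤ)

/-- **The sampler `f(z, e) = g(z, e) + K t`** (the translate by the scaled target). [cite: GoldreichGoldwasser2000, §3] -/
def sampF (n : ℕ) (K : ℤ) (B : Matrix (Fin n) (Fin n) ℤ) (t : Fin n → ℤ) {ℓ m : ℕ} (ze : Box n ℓ m) :
    Fin n → ℤ :=
  fun i => sampG n K B ze i + K * t i

/-- An input `u : Fin N → F₂` read as an infinite bit sequence (`false` beyond `N`). [folklore] -/
def ext {N : ℕ} (x : Fin N → ZMod 2) : ℕ → Bool := fun k => if h : k < N then decide (x ⟨k, h⟩ = 1) else false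

/-- The number written by the `len` bits starting at position `start`. [folklore] -/
def bitsVal (u : ℕ → Bool) (start len : ℕ) : ℕ := ∑ s ∈ range len, if u (start + s) then 2 ^ s else 0

namespace CVPTup

variable (c : CVPTup)

/-- Coordinate `i` of the lattice part read off the input bits:
`∑_{i' < n} K · B i' i · z_{i'}(u) + e_i(u)`. [folklore] -/
def yQ (u : ℕ → Bool) (i : ℕ) : ℤ :=
  (∑ i' ∈ range c.n, (c.K : ℤ) * c.entry i' i * (bitsVal u (1 + i' * c.ℓ) c.ℓ : ℕ)) +
    (bitsVal u (1 + c.n * c.ℓ + i * c.m) c.m : ℕ)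

/-- Coordinate `i` of the sampler `p` read off the input bits: `yQ + [b(u)] · K t_i`. [folklore] -/
def yP (u : ℕ → Bool) (i : ℕ) : ℤ := c.yQ u i + if u 0 then (c.K : ℤ) * c.tgt i else 0

end CVPTup

/-! ### Sanity -/

/-- The three coefficient lists have length `N`. [folklore] -/
theorem length_cs (c : CVPTup) (i : ℕ) :
    (c.csP i).length = c.N ∧ (c.csQ i).length = c.N ∧ c.csB.length = c.N := by
  simp [CVPTup.csP, CVPTup.csQ, CVPTup.csB, CVPTup.N]

/-- `p` has `n W` programs and `q` has `n W + 1` (registered sanity stub of the definitions file).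
[folklore] -/
theorem latticeDefs_sanity (c : CVPTup) : c.progsP.length = c.n * c.W ∧ c.progsQ.length = c.n * c.W + 1 := by
  simp [CVPTup.progsP, CVPTup.progsQ]

/-! ### The guarded raw map (the function the reduction machine computes) -/

/-- **The guarded instance map on raw data**: the raw map `latRedTup` on tuples whose entry lists
have the lengths announced by `n` (`|flat| = n²`, `|t| = n` — always the case on the `cvpTup` data of
a typed instance), and the fixed NO-instance on the other (junk) tuples.  The guard makes the map
polynomial-time on ALL tuples: on the expensive branch `n ≤ |code|` (a binary `n` with short lists
would otherwise ask for exponentially many programs). [cite: DvirGutfreundRothblumVadhan2010, §4.4] -/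
def latRedG (c : CVPTup) : PEDBPInst :=
  if c.flat.length = c.n * c.n ∧ c.tl.length = c.n then latRedTup c else noI

/-- On the data of a typed instance the guard holds, so the guarded map is the instance map.
[folklore] -/
theorem latRedG_cvpTup (p : GapCVPInstance) : latRedG (GapCodes.cvpTup p) = latRed p := by
  have h1 : CVPTup.flat (GapCodes.cvpTup p) = rowMajor p.1.I.n (GapCodes.matRows p.1.I.basis) := rfl
  have h2 : CVPTup.tl (GapCodes.cvpTup p) = List.ofFn p.1.target := rfl
  have h3 : CVPTup.n (GapCodes.cvpTup p) = p.1.I.n := rfl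
  have hg : (CVPTup.flat (GapCodes.cvpTup p)).length = CVPTup.n (GapCodes.cvpTup p) * CVPTup.n (GapCodes.cvpTup p) ∧
      (CVPTup.tl (GapCodes.cvpTup p)).length = CVPTup.n (GapCodes.cvpTup p) := by
    rw [h1, h2, h3, length_rowMajor, List.length_ofFn]
    exact ⟨rfl, rfl⟩
  unfold latRedG latRed
  rw [if_pos hg]

end Summit.PneNP.PneNP.Cruxes.PeaThreeNotInP.LatticeLine
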